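import Summits.Ventures.PercRepro.S2DichotomyTools
import Summits.Ventures.PercRepro.S2TailCell
import Summits.Ventures.PercRepro.S2SpanningCount
import Summits.Ventures.PercRepro.S2CountsCell
import Summits.Ventures.PercRepro.S2SpreadTail
import Summits.Ventures.PercRepro.S2FlatSharp
import Summits.Ventures.PercRepro.S2BasesTriangles
import Summits.Ventures.PercRepro.S2PhiFourteenFive
import Summits.Ventures.PercRepro.S2CapFree
import Summits.Ventures.PercRepro.TriangleCapEightI
import Summits.Ventures.PercRepro.RankLevelSetFourCircuitNullityFour
import Summits.Ventures.PercRepro.S1FiveCircuitBase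

/-!
# PercRepro — S2: THE SCALED CELL `(13, 6)` COLOOP-FREE AT `K₁ = 13034` — THE FIRST COLOOP CASE OF `(14, 6)` (p7, gen 14; sub-claim S2; the `p = 14` row)

The first coloop step of the cell `(14, 6)`: on `M ＼ {e}` (an `e`-free core of rank `13` on `19` points, coloop-free) the weighted inequality
`(Φ(14,5) − 2)/2 · #U(13, 5) ≤ mid(13, 5)` — the cases `ν = 5, 4` by the concentrated tail, the spread case by the triangle trade-off
(`topCount_le_flat_sharp` at `f = 8`, `f′ = 7`, the spread rank part of the tail, the kit's spanning bound / three triangles' Bonferroni;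
`gencell6.py`). **`ThmN.c025_thirteen_six_cfk1`**. Axioms: standard.
-/

open scoped Matroid

namespace PercRepro

namespace ThmN

open Set

variable {α : Type}

/-- The coloop-free caps at `(13, 6)`: `s₃ ≤ 10`, `s₄ ≤ 35` (`⌊19·28/15⌋` on `avgChain16 5`), `s₅ ≤ 158` (`⌊19·117/14⌋`) on every
`e`-free core of nullity `6` on `19` points without coloops. -/
theorem caps_thirteen_six_cfk1 (M : Matroid α) [M.Finite]
    (hd : M.E.encard = M.eRank + ((6 : ℕ) : ℕ∞)) (hn : M.E.ncard = 13 + 6)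
    (hfree : ∀ e ∈ M.E, ∃ A ⊆ M.E \ {e}, e ∉ M.closure A ∧ e ∉ M.closure ((M.E \ {e}) \ A)) (hK : ∀ e, ¬ M.IsColoop e) :
    {C : Set α | M.IsCircuit C ∧ C.ncard = 3}.ncard ≤ 10 ∧
      {C : Set α | M.IsCircuit C ∧ C.ncard = 4}.ncard ≤ 35 ∧
        {C : Set α | M.IsCircuit C ∧ C.ncard = 5}.ncard ≤ 158 := by
  have hs3 := TriangleCap.core_ncard_triangles_le_cq3 M hfree hd
  rw [show TriangleCap.cq3 6 = 10 by decide] at hs3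
  have hcol : M.coloops = ∅ := S2.coloops_eq_empty_of_forall_not M hK
  have hm : 19 ≤ (M.E \ M.coloops).ncard := by
    rw [hcol, Set.sdiff_empty, hn]
  have hd' : M.E.encard = M.eRank + (((5 : ℕ) : ℕ∞) + 1) := by
    rw [hd]; norm_num
  have h := S1.ncard_fourCircuits_sub_div_le_of_nonColoops M hfree hd' (by norm_num) hm (B := 28)
    (fun M' _ hfree' hd'' => by
      have h := ncard_fourCircuits_le_avgChain16 5 M' hfree' hd''
      rw [show avgChain16 5 = 28 by decide] at h
      exact h)
  have hs4 : {C : Set α | M.IsCircuit C ∧ C.ncard = 4}.ncard ≤ 35 := by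
    have := S1.le_mul_div_of_sub_div_le (by norm_num : 4 < 19) h
    omega
  have hs5 := S2.ncard_fiveCircuits_le_of_no_coloop M hfree hd' hK (by omega)
  rw [hn] at hs5
  have h5 : (13 + 6) * S1.avgChain5b 5 / (13 + 6 - 5) = 158 := by
    rw [show S1.avgChain5b 5 = 117 by decide]
  rw [h5] at hs5
  exact ⟨hs3, hs4, hs5⟩

/-- The tail side of the cell `(13, 6)` on the caps `10 / 35 / 158` with the spanning count `S` a parameter (the kit's rank part `536568767 / 8460`). -/
theorem tail_thirteen_six_cfk1 (S m : ℕ) (h : (1024 : ℚ) * ((536568767 / 8460 : ℚ) + (S : ℚ)) ≤ (m : ℚ) * 2 ^ 19) :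
    1024 * ((((13 + 6).choose 4 : ℚ) +
      (∑ j ∈ Finset.range 6, (Nat.choose (min 5 ((6 + 3) / 2 + 1 - 2)) j : ℚ) / (((j + 1) + 3 * (j + 1).choose 2 + 3 * (j + 1).choose 3 + 2 * (j + 1).choose 4 : ℕ) : ℚ)) *
        ((10 * (13 + 6 - 3).choose 2 + 35 * (13 + 6 - 4) + 158 : ℕ) : ℚ) +
      ((∑ j ∈ Finset.range 6, (Nat.choose 5 j : ℚ) / (((j + 1) + 3 * (j + 1).choose 2 + 3 * (j + 1).choose 3 + 2 * (j + 1).choose 4 : ℕ) : ℚ)) -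
        (∑ j ∈ Finset.range 6, (Nat.choose (min 5 ((6 + 3) / 2 + 1 - 2)) j : ℚ) / (((j + 1) + 3 * (j + 1).choose 2 + 3 * (j + 1).choose 3 + 2 * (j + 1).choose 4 : ℕ) : ℚ))) *
        ((10 : ℕ).choose 5 : ℚ)) +
      (((13 + 6).choose 3 * 2 ^ 3 + (13 + 6).choose 2 * 2 + (13 + 6) + 1 : ℕ) : ℚ) +
      (((13 + 6).choose 5 : ℚ) + (∑ j ∈ Finset.range (6), (Nat.choose (min 13 ((6 + 6) / 2 + 1 - 2)) j : ℚ) / (((j + 1) + 3 * (j + 1).choose 2 + 3 * (j + 1).choose 3 + 2 * (j + 1).choose 4 : ℕ) : ℚ)) * ((10 * (13 + 6 - 3).choose 3 + 35 * (13 + 6 - 4).choose 2 + 158 * (13 + 6 - 5) + (6 + 5).choose 6 : ℕ) : ℚ) +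
        ((∑ j ∈ Finset.range (6), (Nat.choose (min 19 (5 + 6) - 6) j : ℚ) / (((j + 1) + 3 * (j + 1).choose 2 + 3 * (j + 1).choose 3 + 2 * (j + 1).choose 4 : ℕ) : ℚ)) - (∑ j ∈ Finset.range (6), (Nat.choose (min 13 ((6 + 6) / 2 + 1 - 2)) j : ℚ) / (((j + 1) + 3 * (j + 1).choose 2 + 3 * (j + 1).choose 3 + 2 * (j + 1).choose 4 : ℕ) : ℚ))) *
        ((min 19 (5 + 6)).choose 6 : ℚ)) +
      (S : ℚ)) ≤ (m : ℚ) * 2 ^ (13 + 6) := by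
  have hsm : (∑ j ∈ Finset.range (6), (Nat.choose (min 13 ((6 + 6) / 2 + 1 - 2)) j : ℚ) / (((j + 1) + 3 * (j + 1).choose 2 + 3 * (j + 1).choose 3 + 2 * (j + 1).choose 4 : ℕ) : ℚ)) = 12767 / 4230 := by
    norm_num [Finset.sum_range_succ, Nat.choose]
  have hsg : (∑ j ∈ Finset.range (6), (Nat.choose (min 19 (5 + 6) - 6) j : ℚ) / (((j + 1) + 3 * (j + 1).choose 2 + 3 * (j + 1).choose 3 + 2 * (j + 1).choose 4 : ℕ) : ℚ)) = 12767 / 4230 := by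
    norm_num [Finset.sum_range_succ, Nat.choose]
  have hs4m : (∑ j ∈ Finset.range 6, (Nat.choose (min 5 ((6 + 3) / 2 + 1 - 2)) j : ℚ) / (((j + 1) + 3 * (j + 1).choose 2 + 3 * (j + 1).choose 3 + 2 * (j + 1).choose 4 : ℕ) : ℚ)) = 329 / 180 := by
    norm_num [Finset.sum_range_succ, Nat.choose]
  have hs4g : (∑ j ∈ Finset.range 6, (Nat.choose 5 j : ℚ) / (((j + 1) + 3 * (j + 1).choose 2 + 3 * (j + 1).choose 3 + 2 * (j + 1).choose 4 : ℕ) : ℚ)) = 12767 / 4230 := by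
    norm_num [Finset.sum_range_succ, Nat.choose]
  rw [hsm, hsg, hs4m, hs4g]
  norm_num [Nat.choose] at h ⊢
  linarith

/-- **The coloop-free cell `(13, 6)` at `K = 13034`**: the cases `ν = 5, 4` by the concentrated tail, the spread case by the triangle trade-off
(`s₃ ≤ 8`: the sharp count `21525` against the kit's spanning bound, need `21689`; `s₃ ≥ 9`: `22422` against three triangles'
Bonferroni, need `22453`); the rank part of the tail at `f = 8`, `f′ = 7`. -/
theorem c025_thirteen_six_cfk1 (M : Matroid α) [M.Finite]
    (hR : M.eRank = ((13 : ℕ) : ℕ∞)) (hn : M.E.ncard = 13 + 6)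
    (hfree : ∀ e ∈ M.E, ∃ A ⊆ M.E \ {e}, e ∉ M.closure A ∧ e ∉ M.closure ((M.E \ {e}) \ A)) (hK : ∀ e, ¬ M.IsColoop e) :
    ((phiK 14 5 - 2) / 2) * (Matroid.topCount M 13 5 : ℚ) ≤ (Matroid.midCount M 13 5 : ℚ) := by
  classical
  have hd : M.E.encard = M.eRank + ((6 : ℕ) : ℕ∞) := by
    rw [hR, ← M.ground_finite.cast_ncard_eq, hn]
    push_cast
    ring
  obtain ⟨hs3, hs4, hs5⟩ := caps_thirteen_six_cfk1 M hd hn hfree hK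
  have full : ∀ (k : ℕ) {W : Set α}, W ⊆ M.E → W.encard = M.eRk W + k →
      Matroid.topCount M 13 5 ≤ ∑ m ∈ Finset.Icc 5 6, ∑ j ∈ Finset.Icc (m + k - 6) m,
        W.ncard.choose j * (13 + 6 - W.ncard).choose (m - j) := by
    intro k W hW hWk
    refine (S2.topCount_le_sum_spanning M hR hd 5).trans ?_
    refine Finset.sum_le_sum (fun m _ => ?_)
    have h := S2.ncard_spanning_compl_le_of_nullity M hW hd hWk (m := m)
    rw [hn] at h
    exact h
  have span : ∀ (k : ℕ) {W : Set α}, W ⊆ M.E → W.encard = M.eRk W + k →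
      {X : Set α | X ⊆ M.E ∧ M.eRk X = M.eRank}.ncard ≤ ∑ m ∈ Finset.range (6 + 1), ∑ j ∈ Finset.Icc (m + k - 6) m,
        W.ncard.choose j * (13 + 6 - W.ncard).choose (m - j) := by
    intro k W hW hWk
    have h := S2.ncard_spanning_le_of_nullity M hW hd hWk
    rw [hn] at h
    exact h
  have cell : ∀ (U S m : ℕ), Matroid.topCount M 13 5 ≤ U → {X : Set α | X ⊆ M.E ∧ M.eRk X = M.eRank}.ncard ≤ S → m ≤ 1024 →
      1024 * (U : ℚ) ≤ ((1024 - m : ℕ) : ℚ) * 2 ^ (6 - 5) * (13034 : ℚ) →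
      (1024 : ℚ) * ((536568767 / 8460 : ℚ) + (S : ℚ)) ≤ (m : ℚ) * 2 ^ 19 → ((phiK 14 5 - 2) / 2) * (Matroid.topCount M 13 5 : ℚ) ≤ (Matroid.midCount M 13 5 : ℚ) := by
    intro U S m hU hS hm hpoly htail
    exact c025_core_five_cell_of_topCount_spanning_xqictq5g M 13 6 (by norm_num) hR hn hfree 10 35 158 hs3 hs4 hs5 U hU S hS
      13034 (by norm_num) (((phiK 14 5 - 2) / 2)) (by rw [S2.phiK_fourteen_five]; norm_num) ⟨m, hm, hpoly, tail_thirteen_six_cfk1 S m htail⟩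
  have cellA : ∀ (U S m : ℕ) (A : ℚ), Matroid.topCount M 13 5 ≤ U → {X : Set α | X ⊆ M.E ∧ M.eRk X = M.eRank}.ncard ≤ S → m ≤ 1024 →
      1024 * (U : ℚ) ≤ ((1024 - m : ℕ) : ℚ) * 2 ^ (6 - 5) * (13034 : ℚ) →
      (1024 : ℚ) * (A + (S : ℚ)) ≤ (m : ℚ) * 2 ^ 19 →
      ({X : Set α | X ⊆ M.E ∧ M.eRk X ≤ 5}.ncard : ℚ) ≤ A → ((phiK 14 5 - 2) / 2) * (Matroid.topCount M 13 5 : ℚ) ≤ (Matroid.midCount M 13 5 : ℚ) := by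
    intro U S m A hU hS hm hpoly htail hA
    exact c025_core_five_cell_of_counts_xqictq5g M 13 6 (by norm_num) hR hn U hU _ hA S hS
      13034 (by norm_num) (((phiK 14 5 - 2) / 2)) (by rw [S2.phiK_fourteen_five]; norm_num) ⟨m, hm, hpoly, htail⟩
  by_cases h5 : ∃ W ⊆ M.E, W.ncard ≤ 10 ∧ W.encard = M.eRk W + 5
  · obtain ⟨W, hW, hWn, hWk⟩ := h5
    have hU' : Matroid.topCount M 13 5 ≤ 4620 := by
      refine (full 5 hW hWk).trans ?_
      generalize W.ncard = w at hWn ⊢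
      interval_cases w <;> decide
    have hS' : {X : Set α | X ⊆ M.E ∧ M.eRk X = M.eRank}.ncard ≤ 6590 := by
      refine (span 5 hW hWk).trans ?_
      generalize W.ncard = w at hWn ⊢
      interval_cases w <;> decide
    exact cell 4620 6590 137 hU' hS' (by norm_num) (by norm_num) (by norm_num)
  by_cases h4 : ∃ W ⊆ M.E, W.ncard ≤ 9 ∧ W.encard = M.eRk W + 4
  · obtain ⟨W, hW, hWn, hWk⟩ := h4
    have hU' : Matroid.topCount M 13 5 ≤ 12180 := by
      refine (full 4 hW hWk).trans ?_
      generalize W.ncard = w at hWn ⊢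
      interval_cases w <;> decide
    have hS' : {X : Set α | X ⊆ M.E ∧ M.eRk X = M.eRank}.ncard ≤ 15806 := by
      refine (span 4 hW hWk).trans ?_
      generalize W.ncard = w at hWn ⊢
      interval_cases w <;> decide
    exact cell 12180 15806 155 hU' hS' (by norm_num) (by norm_num) (by norm_num)
  · -- spread: rank-`5` sets `≤ 8`, rank-`4` sets `≤ 7`; the triangle trade-off
    have hflat : ∀ X ⊆ M.E, M.eRk X ≤ 5 → X.ncard ≤ 8 := fun X hX hr => by
      have := S2.ncard_le_of_eRk_le_of_not_nullity M 4 9 (by norm_num) h4 hX (r := 5) (by norm_num) (by exact_mod_cast hr)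
      omega
    have hflat' : ∀ X ⊆ M.E, M.eRk X ≤ 4 → X.ncard ≤ 7 := fun X hX hr => by
      have := S2.ncard_le_of_eRk_le_of_not_nullity M 4 9 (by norm_num) h4 hX (r := 4) (by norm_num) (by exact_mod_cast hr)
      omega
    have hA := ncard_eRk_le_five_le_spread M 13 6 (by norm_num) hR hn hfree hflat hflat' 10 35 158 hs3 hs4 hs5
    have hEcard : M.ground_finite.toFinset.card = 13 + 6 := by
      rw [← Set.ncard_eq_toFinset_card _ M.ground_finite]; exact hn
    by_cases ht : {C : Set α | M.IsCircuit C ∧ C.ncard = 3}.ncard ≤ 8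
    · have hU := topCount_le_flat_sharp M 13 6 (by norm_num) (by norm_num) hR hn hfree 8 7 hflat hflat' (by norm_num) (by norm_num)
        8 35 158 ht hs4 hs5
      norm_num [Finset.sum_range_succ, Nat.choose] at hU
      have hU' : Matroid.topCount M 13 5 ≤ 21525 := hU.trans (by norm_num)
      have hS := Matroid.ncard_spanning_le (M := M) hd
      rw [hEcard] at hS
      have hS' : {X : Set α | X ⊆ M.E ∧ M.eRk X = M.eRank}.ncard ≤ 43796 := hS.trans (by decide)
      exact cellA 21525 43796 172 _ hU' hS' (by norm_num) (by norm_num) (by norm_num [Nat.choose]) hA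
    · push Not at ht
      have hU := topCount_le_flat_sharp M 13 6 (by norm_num) (by norm_num) hR hn hfree 8 7 hflat hflat' (by norm_num) (by norm_num)
        10 35 158 hs3 hs4 hs5
      norm_num [Finset.sum_range_succ, Nat.choose] at hU
      have hU' : Matroid.topCount M 13 5 ≤ 22422 := hU.trans (by norm_num)
      have hL0 : ∀ e ∈ M.E, ¬ M.IsLoop e := not_isLoop_of_free M hfree
      have hs : ∀ e ∈ M.E, ∀ f ∈ M.E, e ≠ f → M.eRk {e, f} = 2 := by
        intro e he f hf hef
        have h2 : (2 : ℕ∞) ≤ M.eRk {e, f} :=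
          two_le_eRk_of_two_le_ncard_of_free M hfree (pair_subset he hf) (by rw [ncard_pair hef])
        have h3 : M.eRk {e, f} ≤ 2 := by
          have := M.eRk_le_encard {e, f}
          rwa [encard_pair hef] at this
        exact le_antisymm h3 h2
      have hC1 : ∀ L ⊆ M.E, M.eRk L = 2 → L.ncard ≤ 3 :=
        fun L hL hr => ncard_le_three_of_eRk_two M hs hfree hL hr
      have hTfin : {C : Set α | M.IsCircuit C ∧ C.ncard = 3}.Finite :=
        M.ground_finite.finite_subsets.subset (fun C hC => hC.1.subset_ground)
      obtain ⟨T₁, T₂, T₃, hT₁, hT₂, hT₃, h12, h13, h23⟩ := (Set.two_lt_ncard_iff hTfin).1 (by omega)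
      have hS := S2.ncard_spanning_add_le_of_three_triangles M hR hn (by norm_num) hC1 hT₁.1 hT₁.2 hT₂.1 hT₂.2 hT₃.1 hT₃.2 h12 h13 h23
      norm_num [Finset.sum_range_succ, Nat.choose] at hS
      have hS' : {X : Set α | X ⊆ M.E ∧ M.eRk X = M.eRank}.ncard ≤ 28781 := by omega
      exact cellA 22422 28781 142 _ hU' hS' (by norm_num) (by norm_num) (by norm_num [Nat.choose]) hA

end ThmN

end PercRepro
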